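import Summits.RiemannHypothesis.RiemannHypothesis.Theses.RuelleBand
import Literature.Analysis.OperatorTheory.CompactPerturbationSpectrum
import Literature.Analysis.OperatorTheory.CompactNearIdentityFiniteDim

/-!
# Route `RuelleBand`: the abstract band ENGINE in compact-perturbation generality (core lemmas)

Prover file (line lead of crux `AsymptoticCriticalLine`, stmt-RiemannHypothesis-2063, whose route deps
are `BandRealisation` and `BandEngine`).  Everything is proved; no definitions.  Consumed by
`RuelleBandBandEngine.lean` (`bandEngine_proof : BandEngine`, stmt-RiemannHypothesis-2065, and
`realisationToAsymptotic_proof : RealisationToAsymptotic`, stmt-RiemannHypothesis-2066).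

`RuelleBand.finite_jointEigenvalues_of_compact_perturbation` — let `t ↦ T t` be ANY family of bounded
operators on a complex Hilbert space `H` indexed by `ℝ` (no group law, no continuity), `t₀ : ℝ`, and
`T t₀ = S + K` with `K` compact.  Let `D ⊆ ρ(S)` be open and connected and contain one resolvent point
of `T t₀`, and let `C ⊆ D` be compact.  Then the JOINT EIGENVALUES `z` of the family
(`T t v = e^{tz} v` for all `t`, some `v ≠ 0`) with `e^{t₀ z} ∈ C` form a FINITE set.  Proof: by the
analytic Fredholm theorem in the tree's form `spectrum_add_compact_isolated_eigenvalues`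
(Reed–Simon I Thm VI.14 ⟹ the spectrum of `S + K` in `D` is discrete), `σ(T t₀) ∩ C` is finite
(compactness: `finite_spectrum_inter_of_isolated`); each eigenspace `ker (T t₀ − μ)`, `μ ∈ D`, is
finite-dimensional (it is fixed by the compact operator `R_S(μ) K`; Riesz,
`finiteDimensional_of_isCompactOperator_of_norm_sub_le`); and joint eigenvectors with distinct
characters are linearly independent (`linearIndependent_of_jointEigenvector`: pick a time `t₁` at which
the finitely many `e^{t₁ z}` are distinct, `exists_time_injective`, and use Mathlib's
`Module.End.eigenvectors_linearIndependent'`), so each fibre `{z : e^{t₀ z} = μ}` is finite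
(`finite_fibre_of_finiteDimensional`).  This is the similarity-invariant form asked for by refuter #3's
typing constraint (γ) on the route: only `σ(S) ∩ D = ∅` and one resolvent point per component are used —
with `S` unitary and `D = {‖μ‖ ≠ 1}` it gives `BandEngine`; with `σ(S)` inside three circles
`{1, e^{±(1/2−a)t₀}}` and `D` an open annulus between them it is the THREE-CIRCLE ENGINE of the line
`interior-edge-split` (`RuelleBand.finite_jointEigenvalues_annulus`), whose output for realised zeros is
the interior half `NoRightInteriorBand` of the crux and never the edge.
-/

noncomputable section

namespace Summit.RiemannHypothesis.RiemannHypothesis.Theorems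

open Complex Filter Topology Set Metric
open Literature.Analysis.OperatorTheory

namespace RuelleBand

variable {H : Type} [NormedAddCommGroup H] [InnerProductSpace ℂ H] [CompleteSpace H]

/-! ## 1. Discrete spectrum in `D` ⟹ finitely many spectral points on a compact `C ⊆ D` -/

omit [CompleteSpace H] in
/-- If every point of `D` has a punctured neighbourhood inside the resolvent set of `A`, then the
spectrum of `A` meets every compact `C ⊆ D` in a finite set (cover `C` by such neighbourhoods and keep
finitely many: a spectral point of `C` must be one of the finitely many centres). -/
theorem finite_spectrum_inter_of_isolated (A : H →L[ℂ] H) {D C : Set ℂ}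
    (h : ∀ z ∈ D, ∀ᶠ w in 𝓝[≠] z, w ∈ resolventSet ℂ A) (hC : IsCompact C) (hCD : C ⊆ D) :
    (spectrum ℂ A ∩ C).Finite := by
  classical
  set U : ℂ → Set ℂ := fun a => {w | w ≠ a → w ∈ resolventSet ℂ A} with hU
  have hUn : ∀ a ∈ C, U a ∈ 𝓝 a := by
    intro a ha
    have := h a (hCD ha)
    rw [eventually_nhdsWithin_iff] at this
    exact this
  obtain ⟨t, htC, hcover⟩ := hC.elim_nhds_subcover U hUn
  refine t.finite_toSet.subset ?_
  rintro μ ⟨hμσ, hμC⟩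
  obtain ⟨a, hat, hμa⟩ := mem_iUnion₂.1 (hcover hμC)
  by_contra hμt
  have hne : μ ≠ a := fun e => hμt (e ▸ hat)
  exact (spectrum.mem_iff.1 hμσ) (spectrum.mem_resolventSet_iff.1 (hμa hne))

/-! ## 2. Eigenspaces of `S + K` off `σ(S)` are finite-dimensional -/

/-- For `μ ∈ ρ(S)` and `K` compact, the eigenspace `ker (S + K − μ)` is finite-dimensional: an
eigenvector `ψ` satisfies `R_S(μ) K ψ = ψ`, i.e. the compact operator `R_S(μ) K` is the identity on
the (closed) eigenspace — Riesz (`finiteDimensional_of_isCompactOperator_of_norm_sub_le`, `c = 0`). -/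
theorem finiteDimensional_eigenspace_add_compact (S K : H →L[ℂ] H) (hK : IsCompactOperator K)
    {μ : ℂ} (hμ : μ ∈ resolventSet ℂ S) :
    FiniteDimensional ℂ
      (LinearMap.ker ((S + K - μ • (1 : H →L[ℂ] H) : H →L[ℂ] H) : H →ₗ[ℂ] H)) := by
  set V : Submodule ℂ H :=
    LinearMap.ker ((S + K - μ • (1 : H →L[ℂ] H) : H →L[ℂ] H) : H →ₗ[ℂ] H) with hV
  have hVc : IsClosed ((V : Submodule ℂ H) : Set H) :=
    ContinuousLinearMap.isClosed_ker (S + K - μ • (1 : H →L[ℂ] H))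
  have hu : IsUnit (algebraMap ℂ (H →L[ℂ] H) μ - S) := spectrum.mem_resolventSet_iff.1 hμ
  refine finiteDimensional_of_isCompactOperator_of_norm_sub_le (T := resolvent S μ * K)
    (isCompactOperator_resolvent_mul S hK μ) V hVc (c := 0) zero_lt_one fun v hv => ?_
  -- `R K v = v` on the eigenspace
  have hv' : S v + K v = μ • v := by
    have h0 := LinearMap.mem_ker.1 hv
    simp only [ContinuousLinearMap.coe_coe] at h0
    have h1 : (S + K - μ • (1 : H →L[ℂ] H)) v = S v + K v - μ • v := rfl
    rw [h1, sub_eq_zero] at h0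
    exact h0
  have hαS : (algebraMap ℂ (H →L[ℂ] H) μ - S) v = μ • v - S v := by
    rw [Algebra.algebraMap_eq_smul_one]; rfl
  have hKv : K v = (algebraMap ℂ (H →L[ℂ] H) μ - S) v := by
    rw [hαS, ← hv']; abel
  have hRK : (resolvent S μ * K) v = v := by
    change resolvent S μ (K v) = v
    rw [hKv]
    change (resolvent S μ * (algebraMap ℂ (H →L[ℂ] H) μ - S)) v = v
    rw [resolvent, Ring.inverse_mul_cancel _ hu]
    rfl
  rw [hRK, sub_self, norm_zero, zero_mul]

/-! ## 3. Joint eigenvectors with distinct characters are linearly independent -/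

/-- A time at which finitely many distinct exponents have distinct exponentials: for an injective
`z : ι → ℂ` (`ι` finite) there is `t₁ : ℝ` with `i ↦ e^{t₁ z i}` injective. Take
`t₁ = 1/(∑ ‖z i‖ + 1)`: then `‖t₁ (z i − z j)‖ < 2 < 2π`, so `e^{t₁ z i} = e^{t₁ z j}` forces
`t₁ z i = t₁ z j` (`Complex.exp_eq_exp_iff_exists_int`). -/
theorem exists_time_injective {ι : Type*} [Fintype ι] (z : ι → ℂ) (hz : Function.Injective z) :
    ∃ t₁ : ℝ, 0 < t₁ ∧ Function.Injective fun i => Complex.exp ((t₁ : ℂ) * z i) := by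
  set B : ℝ := ∑ i, ‖z i‖ + 1 with hB
  have hB0 : 0 < B := by
    have : 0 ≤ ∑ i, ‖z i‖ := Finset.sum_nonneg fun i _ => norm_nonneg _
    linarith
  have hle : ∀ i, ‖z i‖ ≤ B - 1 := fun i => by
    have := Finset.single_le_sum (f := fun i => ‖z i‖) (fun i _ => norm_nonneg _) (Finset.mem_univ i)
    simp only [hB]; linarith
  refine ⟨1 / B, by positivity, fun i j hij => ?_⟩
  simp only at hij
  obtain ⟨n, hn⟩ := Complex.exp_eq_exp_iff_exists_int.1 hij
  -- the norm of the difference is `|n| · 2π < 2π`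
  have hdiff : ((1 / B : ℝ) : ℂ) * (z i - z j) = n * (2 * Real.pi * I) := by
    rw [mul_sub, hn]; ring
  have hnorm : ‖((1 / B : ℝ) : ℂ) * (z i - z j)‖ ≤ (1 / B) * (2 * (B - 1)) := by
    rw [norm_mul, Complex.norm_real, Real.norm_of_nonneg (by positivity)]
    refine mul_le_mul_of_nonneg_left ?_ (by positivity)
    calc ‖z i - z j‖ ≤ ‖z i‖ + ‖z j‖ := norm_sub_le _ _
      _ ≤ (B - 1) + (B - 1) := add_le_add (hle i) (hle j)
      _ = 2 * (B - 1) := by ring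
  have hlt : (1 / B) * (2 * (B - 1)) < 2 * Real.pi := by
    have h1 : (1 / B) * (2 * (B - 1)) < 2 := by
      rw [div_mul_eq_mul_div, one_mul, div_lt_iff₀ hB0]; linarith
    have h2 : (2 : ℝ) ≤ 2 * Real.pi := by have := Real.pi_gt_three; linarith
    linarith
  have hn0 : n = 0 := by
    have hN : ‖(n : ℂ) * (2 * Real.pi * I)‖ = |(n : ℝ)| * (2 * Real.pi) := by
      rw [norm_mul, Complex.norm_intCast]
      congr 1
      rw [norm_mul, norm_mul, Complex.norm_I, mul_one, Complex.norm_real, Complex.norm_ofNat,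
        Real.norm_of_nonneg Real.pi_pos.le]
    have : |(n : ℝ)| * (2 * Real.pi) < 1 * (2 * Real.pi) := by
      rw [← hN, ← hdiff, one_mul]; exact hnorm.trans_lt hlt
    have habs : |(n : ℝ)| < 1 := lt_of_mul_lt_mul_right this (by positivity)
    have : |n| < 1 := by exact_mod_cast habs
    exact Int.abs_lt_one_iff.1 this
  subst hn0
  have hzij : ((1 / B : ℝ) : ℂ) * z i = ((1 / B : ℝ) : ℂ) * z j := by simpa using hn
  have hB' : ((1 / B : ℝ) : ℂ) ≠ 0 := by
    rw [Ne, Complex.ofReal_eq_zero]; positivity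
  exact hz (mul_left_cancel₀ hB' hzij)

omit [CompleteSpace H] in
/-- Joint eigenvectors of a family `t ↦ T t` with pairwise distinct characters `t ↦ e^{t z_i}` are
linearly independent: they are eigenvectors of the single operator `T t₁` for the pairwise distinct
eigenvalues `e^{t₁ z_i}` (`exists_time_injective`), Mathlib `Module.End.eigenvectors_linearIndependent'`. -/
theorem linearIndependent_of_jointEigenvector (T : ℝ → H →L[ℂ] H) {ι : Type*} [Fintype ι]
    (z : ι → ℂ) (hz : Function.Injective z) (v : ι → H) (hv0 : ∀ i, v i ≠ 0)
    (hv : ∀ i (t : ℝ), T t (v i) = Complex.exp ((t : ℂ) * z i) • v i) : LinearIndependent ℂ v := by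
  obtain ⟨t₁, -, hinj⟩ := exists_time_injective z hz
  refine Module.End.eigenvectors_linearIndependent' ((T t₁ : H →L[ℂ] H) : H →ₗ[ℂ] H)
    (fun i => Complex.exp ((t₁ : ℂ) * z i)) hinj v fun i => ?_
  exact Module.End.hasEigenvector_iff.2 ⟨Module.End.mem_eigenspace_iff.2 (hv i t₁), hv0 i⟩

omit [CompleteSpace H] in
/-- FINITE FIBRES: if the eigenspace `ker (A − μ)` is finite-dimensional, only finitely many joint
eigenvalues `z` of the family have `e^{t₀ z} = μ` when `T t₀ = A` — a finite set of them of size `n`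
gives `n` linearly independent vectors inside the eigenspace. -/
theorem finite_fibre_of_finiteDimensional (T : ℝ → H →L[ℂ] H) (t₀ : ℝ) (A : H →L[ℂ] H)
    (hA : T t₀ = A) (μ : ℂ)
    (hfin : FiniteDimensional ℂ
      (LinearMap.ker ((A - μ • (1 : H →L[ℂ] H) : H →L[ℂ] H) : H →ₗ[ℂ] H))) :
    {z : ℂ | Complex.exp ((t₀ : ℂ) * z) = μ ∧
      ∃ v : H, v ≠ 0 ∧ ∀ t : ℝ, T t v = Complex.exp ((t : ℂ) * z) • v}.Finite := by
  classical
  set E : Submodule ℂ H := LinearMap.ker ((A - μ • (1 : H →L[ℂ] H) : H →L[ℂ] H) : H →ₗ[ℂ] H)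
    with hE
  set d : ℕ := Module.finrank ℂ E with hd
  by_contra hinf
  obtain ⟨s, hsub, hcard⟩ := Set.Infinite.exists_subset_card_eq hinf (d + 1)
  -- choose joint eigenvectors for the `d + 1` points of `s`
  have hmem : ∀ z : s, ∃ v : H, v ≠ 0 ∧ ∀ t : ℝ, T t v = Complex.exp ((t : ℂ) * (z : ℂ)) • v :=
    fun z => (hsub z.2).2
  choose v hv0 hv using hmem
  have hzinj : Function.Injective (fun z : s => (z : ℂ)) := Subtype.coe_injective
  have hli : LinearIndependent ℂ v := linearIndependent_of_jointEigenvector T (fun z : s => (z : ℂ))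
    hzinj v hv0 hv
  -- the eigenvectors lie in the eigenspace `E`
  have hvE : ∀ z : s, v z ∈ E := by
    intro z
    have h1 := hv z t₀
    rw [hA, (hsub z.2).1] at h1
    refine LinearMap.mem_ker.2 ?_
    simp only [ContinuousLinearMap.coe_coe]
    have h2 : (A - μ • (1 : H →L[ℂ] H)) (v z) = A (v z) - μ • v z := rfl
    rw [h2, h1, sub_self]
  -- restrict to `E` and count
  set w : s → E := fun z => ⟨v z, hvE z⟩ with hw
  have hli' : LinearIndependent ℂ w := by
    refine LinearIndependent.of_comp E.subtype ?_
    convert hli using 1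
    funext z
    simp [hw]
  haveI : FiniteDimensional ℂ E := hfin
  have hle := hli'.fintype_card_le_finrank
  rw [← hd, Fintype.card_coe, hcard] at hle
  omega

/-! ## 4. The engine -/

/-- An eigenvalue of `T t₀` lies in its spectrum. -/
theorem exp_mem_spectrum_of_jointEigenvector (T : ℝ → H →L[ℂ] H) (t₀ : ℝ) {z : ℂ} {v : H}
    (hv0 : v ≠ 0) (hv : T t₀ v = Complex.exp ((t₀ : ℂ) * z) • v) :
    Complex.exp ((t₀ : ℂ) * z) ∈ spectrum ℂ (T t₀) := by
  rw [spectrum.mem_iff]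
  intro hu
  obtain ⟨W, hW⟩ := hu
  have hinj : Function.Injective (algebraMap ℂ (H →L[ℂ] H) (Complex.exp ((t₀ : ℂ) * z)) - T t₀) := by
    rw [← hW]
    exact (ContinuousLinearMap.isUnit_iff_bijective.1 W.isUnit).1
  have h0 : (algebraMap ℂ (H →L[ℂ] H) (Complex.exp ((t₀ : ℂ) * z)) - T t₀) v = 0 := by
    have h1 : (algebraMap ℂ (H →L[ℂ] H) (Complex.exp ((t₀ : ℂ) * z)) - T t₀) v =
        Complex.exp ((t₀ : ℂ) * z) • v - T t₀ v := by
      rw [Algebra.algebraMap_eq_smul_one]; rfl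
    rw [h1, hv, sub_self]
  exact hv0 (hinj (h0.trans (map_zero _).symm))

/-- **THE ENGINE (compact-perturbation form).** Let `t ↦ T t` be any `ℝ`-indexed family of bounded
operators on a complex Hilbert space, `T t₀ = S + K` with `K` compact, `D ⊆ ρ(S)` open, connected and
containing a resolvent point `μ₀` of `T t₀`, and `C ⊆ D` compact. Then the joint eigenvalues `z`
(`T t v = e^{tz} v` for all `t`, some `v ≠ 0`) with `e^{t₀ z} ∈ C` form a finite set. (Analytic
Fredholm theorem via `spectrum_add_compact_isolated_eigenvalues`; Riesz; linear independence of joint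
eigenvectors.) The similarity-invariant content of Faure–Tsujii's "unitary modulo compact on a band". -/
theorem finite_jointEigenvalues_of_compact_perturbation (T : ℝ → H →L[ℂ] H) (t₀ : ℝ)
    (S K : H →L[ℂ] H) (hK : IsCompactOperator K) (hSK : T t₀ = S + K)
    {D : Set ℂ} (hD : IsOpen D) (hDc : IsConnected D) (hDS : D ⊆ resolventSet ℂ S)
    {μ₀ : ℂ} (hμ₀ : μ₀ ∈ D) (hμ₀ρ : μ₀ ∈ resolventSet ℂ (T t₀))
    {C : Set ℂ} (hC : IsCompact C) (hCD : C ⊆ D) :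
    {z : ℂ | Complex.exp ((t₀ : ℂ) * z) ∈ C ∧
      ∃ v : H, v ≠ 0 ∧ ∀ t : ℝ, T t v = Complex.exp ((t : ℂ) * z) • v}.Finite := by
  rw [hSK] at hμ₀ρ
  obtain ⟨h1, -⟩ := spectrum_add_compact_isolated_eigenvalues S K hK hD hDc hDS hμ₀ hμ₀ρ
  -- finitely many spectral points on `C`
  have hA : (spectrum ℂ (S + K) ∩ C).Finite := finite_spectrum_inter_of_isolated (S + K) h1 hC hCD
  -- each fibre is finite
  have hF : ∀ μ ∈ spectrum ℂ (S + K) ∩ C,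
      {z : ℂ | Complex.exp ((t₀ : ℂ) * z) = μ ∧
        ∃ v : H, v ≠ 0 ∧ ∀ t : ℝ, T t v = Complex.exp ((t : ℂ) * z) • v}.Finite := by
    rintro μ ⟨-, hμC⟩
    exact finite_fibre_of_finiteDimensional T t₀ (S + K) hSK μ
      (finiteDimensional_eigenspace_add_compact S K hK (hDS (hCD hμC)))
  refine (hA.biUnion hF).subset ?_
  rintro z ⟨hzC, v, hv0, hv⟩
  have hσ : Complex.exp ((t₀ : ℂ) * z) ∈ spectrum ℂ (S + K) := by
    rw [← hSK]; exact exp_mem_spectrum_of_jointEigenvector T t₀ hv0 (hv t₀)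
  exact mem_biUnion (⟨hσ, hzC⟩ : Complex.exp ((t₀ : ℂ) * z) ∈ spectrum ℂ (S + K) ∩ C) ⟨rfl, v, hv0, hv⟩

/-! ## 5. Geometry: exteriors of discs and annuli are connected (images of strips under `exp`) -/

/-- `exp` maps the vertical strip/half-plane `{a < Re w} ∩ {Re w < b}` onto the annulus
`{e^a < ‖μ‖ < e^b}`; stated for the half-plane `{a < Re w}` and the exterior `{e^a < ‖μ‖}`. -/
theorem exp_image_halfPlane (a : ℝ) :
    Complex.exp '' {w : ℂ | a < w.re} = {μ : ℂ | Real.exp a < ‖μ‖} := by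
  ext μ
  simp only [mem_image, mem_setOf_eq]
  constructor
  · rintro ⟨w, hw, rfl⟩
    rw [Complex.norm_exp]; exact Real.exp_lt_exp.2 hw
  · intro hμ
    have hμ0 : μ ≠ 0 := by
      rintro rfl; rw [norm_zero] at hμ; exact (lt_irrefl _ (hμ.trans (Real.exp_pos a))).elim
    refine ⟨Complex.log μ, ?_, Complex.exp_log hμ0⟩
    rw [Complex.log_re]
    exact (Real.lt_log_iff_exp_lt (norm_pos_iff.2 hμ0)).2 hμ

/-- The exterior `{e^a < ‖μ‖}` of a closed disc is open and connected. -/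
theorem isConnected_exterior (a : ℝ) : IsConnected {μ : ℂ | Real.exp a < ‖μ‖} := by
  rw [← exp_image_halfPlane a]
  refine IsConnected.image ?_ _ Complex.continuous_exp.continuousOn
  exact ⟨⟨(a + 1 : ℝ), by simp⟩, (convex_halfSpace_re_gt a).isPreconnected⟩

/-- `exp` maps the vertical strip `{a < Re w < b}` onto the open annulus `{e^a < ‖μ‖ < e^b}`. -/
theorem exp_image_strip (a b : ℝ) :
    Complex.exp '' {w : ℂ | a < w.re ∧ w.re < b} = {μ : ℂ | Real.exp a < ‖μ‖ ∧ ‖μ‖ < Real.exp b} := by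
  ext μ
  simp only [mem_image, mem_setOf_eq]
  constructor
  · rintro ⟨w, ⟨hw1, hw2⟩, rfl⟩
    rw [Complex.norm_exp]; exact ⟨Real.exp_lt_exp.2 hw1, Real.exp_lt_exp.2 hw2⟩
  · rintro ⟨h1, h2⟩
    have hμ0 : μ ≠ 0 := by
      rintro rfl; rw [norm_zero] at h1; exact (lt_irrefl _ (h1.trans (Real.exp_pos a))).elim
    refine ⟨Complex.log μ, ⟨?_, ?_⟩, Complex.exp_log hμ0⟩
    · rw [Complex.log_re]; exact (Real.lt_log_iff_exp_lt (norm_pos_iff.2 hμ0)).2 h1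
    · rw [Complex.log_re]; exact (Real.log_lt_iff_lt_exp (norm_pos_iff.2 hμ0)).2 h2

/-- An open annulus `{e^a < ‖μ‖ < e^b}` (`a < b`) is connected. -/
theorem isConnected_annulus {a b : ℝ} (hab : a < b) :
    IsConnected {μ : ℂ | Real.exp a < ‖μ‖ ∧ ‖μ‖ < Real.exp b} := by
  rw [← exp_image_strip a b]
  refine IsConnected.image ?_ _ Complex.continuous_exp.continuousOn
  have hconv : Convex ℝ {w : ℂ | a < w.re ∧ w.re < b} := by
    have := (convex_halfSpace_re_gt a).inter (convex_halfSpace_re_lt b)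
    simpa [setOf_and] using this
  refine ⟨⟨(((a + b) / 2 : ℝ) : ℂ), ?_⟩, hconv.isPreconnected⟩
  simp only [mem_setOf_eq, Complex.ofReal_re]
  constructor <;> linarith

/-! ## 6. The three-circle engine (output type of a windowed construction: the interior half) -/

/-- **THREE-CIRCLE / ANNULUS ENGINE** (line `interior-edge-split` of crux stmt-RiemannHypothesis-2063;
refuter #3's typing constraint (γ), corrected to allow essential spectrum on edge circles). If
`T t₀ = S + K` (`t₀ > 0`) with `K` compact and `σ(S)` disjoint from the open annulus
`A = {e^{a t₀} < ‖μ‖ < e^{b t₀}}` (`a < b`; e.g. `σ(S)` inside the circles `‖μ‖ ∈ {1, e^{±r t₀}}`), and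
`A` contains one resolvent point of `T t₀`, then for every `ε > 0` the joint eigenvalues `z` with
`a + ε ≤ Re z ≤ b − ε` are finitely many. With `a = 0`, `b = r = 1/2 − (weight window)` this outputs,
for realised zeros `z = ρ − 1/2`, finiteness of the zeros in every closed slab of `(1/2, 1 − window)` —
exactly the interior stub `NoRightInteriorBand` as the window shrinks, never the edge. -/
theorem finite_jointEigenvalues_annulus (T : ℝ → H →L[ℂ] H) {t₀ : ℝ} (ht₀ : 0 < t₀)
    (S K : H →L[ℂ] H) (hK : IsCompactOperator K) (hSK : T t₀ = S + K) {a b : ℝ} (hab : a < b)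
    (hS : {μ : ℂ | Real.exp (a * t₀) < ‖μ‖ ∧ ‖μ‖ < Real.exp (b * t₀)} ⊆ resolventSet ℂ S)
    {μ₀ : ℂ} (hμ₀ : Real.exp (a * t₀) < ‖μ₀‖ ∧ ‖μ₀‖ < Real.exp (b * t₀))
    (hμ₀ρ : μ₀ ∈ resolventSet ℂ (T t₀)) {ε : ℝ} (hε : 0 < ε) :
    {z : ℂ | (a + ε ≤ z.re ∧ z.re ≤ b - ε) ∧
      ∃ v : H, v ≠ 0 ∧ ∀ t : ℝ, T t v = Complex.exp ((t : ℂ) * z) • v}.Finite := by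
  have hD : IsOpen {μ : ℂ | Real.exp (a * t₀) < ‖μ‖ ∧ ‖μ‖ < Real.exp (b * t₀)} :=
    (isOpen_lt continuous_const continuous_norm).inter (isOpen_lt continuous_norm continuous_const)
  have hDc : IsConnected {μ : ℂ | Real.exp (a * t₀) < ‖μ‖ ∧ ‖μ‖ < Real.exp (b * t₀)} :=
    isConnected_annulus (by nlinarith)
  set C : Set ℂ := {μ : ℂ | Real.exp ((a + ε) * t₀) ≤ ‖μ‖ ∧ ‖μ‖ ≤ Real.exp ((b - ε) * t₀)} with hCdef
  have hCc : IsCompact C := by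
    refine (isCompact_closedBall (0 : ℂ) (Real.exp ((b - ε) * t₀))).of_isClosed_subset ?_ ?_
    · exact (isClosed_le continuous_const continuous_norm).inter (isClosed_le continuous_norm continuous_const)
    · rintro μ ⟨-, h2⟩; simpa using h2
  have hCD : C ⊆ {μ : ℂ | Real.exp (a * t₀) < ‖μ‖ ∧ ‖μ‖ < Real.exp (b * t₀)} := by
    rintro μ ⟨h1, h2⟩
    refine ⟨lt_of_lt_of_le (Real.exp_lt_exp.2 (by nlinarith)) h1,
      lt_of_le_of_lt h2 (Real.exp_lt_exp.2 (by nlinarith))⟩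
  have hfin := finite_jointEigenvalues_of_compact_perturbation T t₀ S K hK hSK hD hDc hS hμ₀ hμ₀ρ hCc hCD
  refine hfin.subset ?_
  rintro z ⟨⟨hz1, hz2⟩, v, hv0, hv⟩
  refine ⟨⟨?_, ?_⟩, v, hv0, hv⟩
  · rw [Complex.norm_exp, Complex.re_ofReal_mul]
    exact Real.exp_le_exp.2 (by nlinarith)
  · rw [Complex.norm_exp, Complex.re_ofReal_mul]
    exact Real.exp_le_exp.2 (by nlinarith)

end RuelleBand

end Summit.RiemannHypothesis.RiemannHypothesis.Theorems

end
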